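import Summits.ResolutionOfSingularities.ResolutionOfSingularities.Theorems.HilbertSamuelEliminationSigmaMaxModificationsCorridor3CPFramePropagationChain
import Summits.ResolutionOfSingularities.ResolutionOfSingularities.Theorems.HilbertSamuelEliminationSigmaMaxModificationsCorridor3CPFramePropagationTracked
import Summits.ResolutionOfSingularities.ResolutionOfSingularities.Theorems.HilbertSamuelEliminationSigmaMaxModificationsCorridor3CPFramePropagationChartAlongTracked
import Summits.ResolutionOfSingularities.ResolutionOfSingularities.Theorems.HilbertSamuelEliminationSigmaMaxModificationsCorridor3CPFrameAdaptedRsop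
import HarnessLib

/-!
# [OURS · L1 W4.2] D18 (G8): the propagation step RE-ASSEMBLED WITH ITS TRANSITION DATA — the new CP frame at a near point comes with the
# frame-ring map `β` (`φ' ∘ π♯ = β ∘ φ`, `β(r) = ι r`, `β(X̄) ∈ (ι u_{j₀})`) and an INDEX-PRESERVING r.s.p. (`u'_{j₀} = ι u_{j₀}` exceptional,
# `ι u_j = ι u_{j₀}·t_j` with `t_j = u'_j` or a unit on the centre's indices, `u'_j = ι u_j` off them)
# (cell res-hironaka, LADDER-RESOLUTION rung L; slot W4.2, crux chain w42 `SigmaMaxModificationsCorridor3` stmt-ResolutionOfSingularities-19249;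
# `--supports stmt-ResolutionOfSingularities-19249 --as helper`; res-L1-w42-plan-1 RULING v3.14-42 part 2 (KG)(2) «(G8) E-adapted propagation»;
# hand res-D-brk-3 (gen 7), file F2c-step of DESIGN 17:06:09Z)

SCHEME-SIDE ASSEMBLY (universe `0`), 0 `def`s, every declaration PROVED; OURS bookkeeping; NOT a statement of Hironaka's manuscript [Hironaka2017]
nor of [CossartJannsenSaito2020]/[CossartPiltant2019]. AI-written, weaker than expert review.

* **`IsCPFrame.exists_isCPFrame_blowup_tracked`** — the landed step `IsCPFrame.exists_isCPFrame_blowup_of_map_stalkIdeal_eq_finset` (p548461: a CP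
  frame reading the centre as `V(X, u_T)` legally propagates to every near point `x'` of `Bl_C` over `x_n`) with the EXTRA OUTPUTS needed to
  propagate boundary readings: the transition map `β : R[X]/(h) → R'[X]/(h')` with `φ'(π♯ a) = β(φ a)` (G2's compatibility kept through the
  tracked links p552824, p552272), a base map `ι : R → R'` with `β(r̄) = ι r` and `β(X̄) ∈ (ι u_{j₀})`, the chart index `j₀ ∈ T`, and the
  index-preserving r.s.p. `u'` of `R'` (p554415): `u'_{j₀} = ι u_{j₀}`; for `j ∈ T ∖ {j₀}`, `ι u_j = ι u_{j₀} · t` with `t = u'_j` or `t` a unit;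
  for `j ∉ T`, `u'_j = ι u_j`.

References: CP 2019 Prop. 2.6–2.7 [CossartPiltant2019]; CJS LNM 2270 Thm. 2.3 [CossartJannsenSaito2020]; de Jong 1996, 2.4 [DeJong1996];
Stacks 0804 [StacksProject].
-/

noncomputable section

set_option linter.dupNamespace false

open CategoryTheory AlgebraicGeometry TopologicalSpace IsLocalRing Polynomial
open Literature.AlgebraicGeometry.Resolution Literature.RingTheory.HilbertSamuel
open Summit.ResolutionOfSingularities.ResolutionOfSingularities.Theorems.CampaignW42
open Summit.ResolutionOfSingularities.ResolutionOfSingularities.Theorems.SigmaMaxModificationsCorridor3.Helpers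

namespace Summit.ResolutionOfSingularities.ResolutionOfSingularities.Theorems.SigmaMaxModificationsCorridor3.Moving

set_option maxHeartbeats 1600000 in
-- long assembly through localisations of affine blowup algebras (as in the landed G6 (c))
/-- [OURS · L1 W4.2] **D18 (i) step with transition data (for E-adapted propagation).** See the module docstring.
[cite: CossartPiltant2019, Prop. 2.6–2.7 (arXiv v1 pp. 13–14)] [cite: CossartJannsenSaito2020, Thm. 2.3 and §2.2] [cite: DeJong1996, 2.4] -/
theorem IsCPFrame.exists_isCPFrame_blowup_tracked {p : ℕ} {R₀ : ∀ S : Scheme.{0}, CentreSeq S → Prop}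
    (hRf : OracleFunctional R₀) (hRa : OracleAdmissible R₀) {ν : ℕ → ℕ} {X₀ : Scheme.{0}} [IsLocallyNoetherian X₀] {x : X₀}
    (hX : IsMaximalOrigin p 3 ν X₀ x) {s : MarkedStage.{0}} (hs : Reaches R₀ 3 ν (MarkedStage.init X₀ x) s)
    (C : s.W.IdealSheafData) (P' : Option (Pending (blowup C))) (hln' : IsLocallyNoetherian (blowup C)) (x' : ↥(blowup C))
    (hcs : IsCanonicalStep R₀ 3 ν s.L s.P C P') (hx' : (blowup.π C).base x' = s.pt) (hcl : IsClosed ({x'} : Set ↥(blowup C)))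
    (hstr : x' ∈ Scheme.hsStratum (blowup C) 3 ν)
    {R : Type} [CommRing R] {u : Fin 3 → R} {h : R[X]}
    {φ : (s.W.presheaf.stalk s.pt : Type) →+* R[X] ⧸ Ideal.span {h}} (hF : IsCPFrame s R u h φ) (T : Finset (Fin 3))
    (hJ : (stalkIdeal C s.pt).map φ =
      ((Ideal.span (u '' ↑T)).map (Polynomial.C : R →+* R[X]) ⊔ Ideal.span {X}).map (Ideal.Quotient.mk (Ideal.span {h})))
    (hcoT : ∀ i ∈ Finset.Icc 1 h.natDegree, h.coeff (h.natDegree - i) ∈ Ideal.span (u '' ↑T) ^ i) :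
    ∃ (R' : Type) (_ : CommRing R') (_ : IsLocalRing R') (u' : Fin 3 → R') (h' : R'[X])
      (φ' : ((blowup C).presheaf.stalk x' : Type) →+* R'[X] ⧸ Ideal.span {h'})
      (β : (R[X] ⧸ Ideal.span {h}) →+* R'[X] ⧸ Ideal.span {h'}) (ι : R →+* R') (j₀ : Fin 3),
      IsCPFrame ⟨blowup C, hln', s.L.next (Scheme.hsStratum s.W 3 ν) C, P', x'⟩ R' u' h' φ' ∧
        IsAdicComplete (maximalIdeal R') R' ∧ h'.natDegree = h.natDegree ∧
      (∀ i < h'.natDegree, h'.coeff i ∈ maximalIdeal R' ^ (h'.natDegree - i)) ∧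
      (∀ a, φ' (((blowup.π C).stalkMap x').hom a) = β (φ ((s.W.presheaf.stalkCongr (Inseparable.of_eq hx')).hom a))) ∧
      (∀ r : R, β (Ideal.Quotient.mk _ (Polynomial.C r)) = Ideal.Quotient.mk _ (Polynomial.C (ι r))) ∧
      β (Ideal.Quotient.mk _ X) ∈ Ideal.span {Ideal.Quotient.mk _ (Polynomial.C (ι (u j₀)))} ∧
      j₀ ∈ T ∧ u' j₀ = ι (u j₀) ∧
      (∀ j ∈ T, j ≠ j₀ → ∃ t : R', ι (u j) = ι (u j₀) * t ∧ (t = u' j ∨ IsUnit t)) ∧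
      (∀ j, j ∉ T → u' j = ι (u j)) := by
  classical
  obtain ⟨hR, -, -, hu, -⟩ := (id hF)
  haveI := hR
  -- enumerate `T` and its complement (as in the landed `_finset` form)
  set eT := T.orderIsoOfFin rfl with heT
  set eTc := Tᶜ.orderIsoOfFin rfl with heTc
  set z : Fin T.card → R := u ∘ (fun i => T.orderEmbOfFin rfl i) with hz
  set y : Fin Tᶜ.card → R := u ∘ (fun i => Tᶜ.orderEmbOfFin rfl i) with hy
  have hzr : Set.range z = u '' ↑T := by
    rw [hz, Set.range_comp]
    exact congrArg _ (Finset.range_orderEmbOfFin T rfl)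
  have hyr : Set.range y = u '' ↑Tᶜ := by
    rw [hy, Set.range_comp]
    exact congrArg _ (Finset.range_orderEmbOfFin Tᶜ rfl)
  have hdl : T.card + Tᶜ.card = 3 := by rw [Finset.card_add_card_compl, Fintype.card_fin]
  have hzy : Ideal.span (Set.range (Fin.append z y)) = maximalIdeal R := by
    rw [range_fin_append, hzr, hyr, ← Set.image_union, ← Finset.coe_union, Finset.union_compl, Finset.coe_univ,
      Set.image_univ, hu]
  have hJ' : (stalkIdeal C s.pt).map φ =
      ((Ideal.span (Set.range z)).map (Polynomial.C : R →+* R[X]) ⊔ Ideal.span {X}).map (Ideal.Quotient.mk (Ideal.span {h})) := by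
    rw [hzr]; exact hJ
  have hcoJ : ∀ i < h.natDegree, h.coeff i ∈ Ideal.span (Set.range z) ^ (h.natDegree - i) := by
    intro i hi
    rw [hzr]
    have h1 := hcoT (h.natDegree - i) (Finset.mem_Icc.mpr ⟨by omega, by omega⟩)
    rwa [show h.natDegree - (h.natDegree - i) = i by omega] at h1
  have hzj : ∀ k : Fin T.card, z k = u (eT k) := fun k => rfl
  have heTmem : ∀ k : Fin T.card, ((eT k : Fin 3)) ∈ T := fun k => (eT k).2
  -- (verbatim from G6 (c)) the near-step data
  have hstep : CanonicalNearStep R₀ 3 ν s ⟨blowup C, hln', s.L.next (Scheme.hsStratum s.W 3 ν) C, P', x'⟩ :=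
    ⟨C, P', hln', x', hcs, hx', hcl, hstr, rfl⟩
  have hm : 0 < h.natDegree := hF.natDegree_pos
  have hH := hilbertFun_stalk_eq_of_canonicalNearStep hRf hRa hX hs hstep
  have hd := ringKrullDim_stalk_eq_of_canonicalNearStep hRf hRa hX hs hstep
  have hF' := hF
  obtain ⟨hR, hloc, hdim, hu, hmon, hφl, hflat, hmap, hsurj, hmin⟩ := hF'
  haveI := hloc
  haveI : IsLocalRing (AdjoinRoot h) := hloc
  haveI : IsLocallyNoetherian s.W := s.ln
  haveI : IsLocallyNoetherian (blowup C) := hln'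
  have hdim3 : ringKrullDim R = ((T.card + Tᶜ.card : ℕ) : WithBot ℕ∞) := by rw [hdl]; exact hdim
  have hzle : Ideal.span (Set.range z) ≤ maximalIdeal R := by
    rw [← hzy]
    exact Ideal.span_mono (Set.range_subset_iff.mpr fun j => ⟨Fin.castAdd Tᶜ.card j, Fin.append_left z y j⟩)
  have hco : ∀ i < h.natDegree, h.coeff i ∈ maximalIdeal R ^ (h.natDegree - i) := fun i hi =>
    Ideal.pow_right_mono hzle _ (hcoJ i hi)
  -- G2: the presentation of `𝒪_{x'}` on a chart algebra of `B = R[X]/(h)`, WITH its compatibility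
  obtain ⟨k, c, j, 𝔔', h𝔔'p, ψ', hc, h1, h2, h3, h4, h5, h6⟩ := hF.exists_chart_presentation C x' hx'
  haveI := h𝔔'p
  have hg : φ (c j) ∈ (stalkIdeal C s.pt).map φ := Ideal.mem_map_of_mem φ (hc ▸ Ideal.subset_span ⟨j, rfl⟩)
  -- G6 (b) tracked: the monic transform over `S = R[(z)/z_{j₀}]`, with `β₂`
  obtain ⟨j₀, h', 𝔔₃, h𝔔₃p, ψ₃, hmon', hdeg', -, h𝔮, hflat₃, hloc₃, hmap₃, hres₃, β₂, hψ₃, hβ₂⟩ :=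
    exists_adjoinRoot_chart_presentation_along_tracked hdim3 z y hzy hmon hcoJ ((stalkIdeal C s.pt).map φ) hJ' hg 𝔔' h1 ψ' h2 h3
      h4 h5
  haveI := h𝔔₃p
  -- G6 (a): the new base `S_𝔮` is regular; `S` is a Noetherian domain
  haveI : ((𝔔₃.comap (AdjoinRoot.mk h')).comap Polynomial.C).IsPrime := Ideal.comap_isPrime _ _
  haveI : IsDomain R := isDomain_of_isRegularLocalRing R
  have hrsop : IsRsopPart z := ⟨inferInstance, Tᶜ.card, y, hdim3, by rw [← range_fin_append, hzy]⟩
  have hprime := prime_algebraMap_blowupAlgebra_of_isRsopPart hrsop j₀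
  have hz0 : z j₀ ≠ 0 := fun h0 => hprime.ne_zero (by rw [h0, map_zero])
  haveI : IsDomain (Localization.Away (z j₀)) :=
    IsLocalization.isDomain_localization (powers_le_nonZeroDivisors_of_noZeroDivisors hz0)
  haveI : IsDomain (blowupAlgebra (Ideal.span (Set.range z)) (z j₀)) := Subalgebra.isDomain _
  haveI : IsNoetherianRing (blowupAlgebra (Ideal.span (Set.range z)) (z j₀)) :=
    isNoetherianRing_blowupAlgebra_of_isNoetherianRing _ _
  have hreg : IsRegularLocalRing (Localization.AtPrime ((𝔔₃.comap (AdjoinRoot.mk h')).comap Polynomial.C)) :=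
    isRegularLocalRing_localization_blowupAlgebra_of_comap_eq_along hdim3 z y hzy j₀ _ h𝔮
  -- nearness in Hilbert–Samuel form, read on `B`
  letI algφ : Algebra (s.W.presheaf.stalk s.pt : Type) (R[X] ⧸ Ideal.span {h}) := φ.toAlgebra
  haveI : Module.Flat (s.W.presheaf.stalk s.pt : Type) (R[X] ⧸ Ideal.span {h}) := hflat
  haveI : IsLocalHom (algebraMap (s.W.presheaf.stalk s.pt : Type) (R[X] ⧸ Ideal.span {h})) := hφl
  have hHB : hilbertFun (R[X] ⧸ Ideal.span {h}) = hilbertFun (s.W.presheaf.stalk s.pt : Type) :=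
    hilbertFun_eq_of_flat_of_map_maximalIdeal_eq (A := (s.W.presheaf.stalk s.pt : Type)) (B := R[X] ⧸ Ideal.span {h}) hmap
  have hdB : ringKrullDim (R[X] ⧸ Ideal.span {h}) = ringKrullDim (s.W.presheaf.stalk s.pt : Type) :=
    Literature.AlgebraicGeometry.Resolution.ringKrullDim_eq_of_flat_of_map_maximalIdeal_eq (s.W.presheaf.stalk s.pt : Type)
      (R[X] ⧸ Ideal.span {h}) hmap
  have hHO : hilbertFun ((blowup C).presheaf.stalk x' : Type) = hilbertFun (AdjoinRoot h) := hH.trans hHB.symm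
  have hdO : ringKrullDim ((blowup C).presheaf.stalk x' : Type) = ringKrullDim (AdjoinRoot h) := hd.trans hdB.symm
  -- G5 (ii-c) tracked: the frame over `S_𝔮`, with `β₃`
  obtain ⟨θ', hloc₁, φ₁, hdimS, hmo₁, hdeg₁, hco₁, hf₁, hl₁, hm₁, hr₁, β₃, hφ₁, hβ₃c, hβ₃X⟩ :=
    exists_local_frame_of_chart_presentation_tracked hmon hm hco _ hreg hmon' hdeg' 𝔔₃ rfl ψ₃ hflat₃ hloc₃ hmap₃ hres₃ hHO hdO
  haveI := hloc₁
  -- the index-preserving adapted r.s.p. of `S_𝔮`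
  have hdimL : ringKrullDim (Localization.AtPrime ((𝔔₃.comap (AdjoinRoot.mk h')).comap Polynomial.C)) = ((T.card + Tᶜ.card : ℕ) : WithBot ℕ∞) := by
    rw [hdimS, hdim3]
  obtain ⟨zL, yL, hspanL, hzL0, hzLA, hyL⟩ :=
    exists_adapted_rsop_localization_blowupAlgebra hdim3 z y hzy j₀ _ h𝔮 hdimL
  let u₁ : Fin 3 → (Localization.AtPrime ((𝔔₃.comap (AdjoinRoot.mk h')).comap Polynomial.C)) := fun jj => if hjj : jj ∈ T then zL (eT.symm ⟨jj, hjj⟩) else yL (eTc.symm ⟨jj, Finset.mem_compl.mpr hjj⟩)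
  have hu₁T : ∀ kk : Fin T.card, u₁ (eT kk) = zL kk := fun kk => by
    simp only [u₁, dif_pos (heTmem kk)]
    congr 1
    exact eT.symm_apply_apply kk
  have hu₁Tc : ∀ kk : Fin Tᶜ.card, u₁ (eTc kk) = yL kk := fun kk => by
    have hnot : ((eTc kk : Fin 3)) ∉ T := Finset.mem_compl.mp (eTc kk).2
    simp only [u₁, dif_neg hnot]
    congr 1
    exact eTc.symm_apply_apply kk
  have hru₁ : Set.range u₁ = Set.range (Fin.append zL yL) := by
    rw [range_fin_append]
    ext w
    constructor
    · rintro ⟨jj, rfl⟩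
      by_cases hjj : jj ∈ T
      · left
        refine ⟨eT.symm ⟨jj, hjj⟩, ?_⟩
        have := hu₁T (eT.symm ⟨jj, hjj⟩)
        rw [eT.apply_symm_apply] at this
        exact this.symm
      · right
        refine ⟨eTc.symm ⟨jj, Finset.mem_compl.mpr hjj⟩, ?_⟩
        have := hu₁Tc (eTc.symm ⟨jj, Finset.mem_compl.mpr hjj⟩)
        rw [eTc.apply_symm_apply] at this
        exact this.symm
    · rintro (⟨kk, rfl⟩ | ⟨kk, rfl⟩)
      · exact ⟨eT kk, hu₁T kk⟩
      · exact ⟨eTc kk, hu₁Tc kk⟩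
  have hu₁ : Ideal.span (Set.range u₁) = maximalIdeal (Localization.AtPrime ((𝔔₃.comap (AdjoinRoot.mk h')).comap Polynomial.C)) := by rw [hru₁, hspanL]
  -- G5 (ii-d) tracked: completion and vertex preparation with the prescribed r.s.p. `u₁`, with `β₄`
  have hm₁' : 0 < ((h'.map (algebraMap _ (Localization.AtPrime ((𝔔₃.comap (AdjoinRoot.mk h')).comap Polynomial.C)))).comp (X + Polynomial.C θ')).natDegree := by rw [hdeg₁]; exact hm
  have hdim3' : ringKrullDim (Localization.AtPrime ((𝔔₃.comap (AdjoinRoot.mk h')).comap Polynomial.C)) = (3 : ℕ) := by rw [hdimS, hdim3, hdl]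
  obtain ⟨R', _, hreg', ι, θ, h₂, hloc₂, φ₂, β₄, hcpl, hdim', hu', hmon₂, hdeg₂, hco₂, hl₂, hf₂, hm₂, hr₂, hmin₂, hφ₂, hβ₄c, hβ₄X⟩ :=
    exists_complete_minimal_frame_tracked hdim3' hmo₁ hm₁' (fun i hi => by
      rw [hdeg₁] at hi ⊢; exact hco₁ i hi) φ₁ hl₁ hf₁ hm₁ hr₁ u₁ hu₁
  haveI := hreg'
  -- the transition data
  obtain ⟨ιR, hιR⟩ : ∃ ιR : R →+* R', ιR = (ι.comp (algebraMap (blowupAlgebra (Ideal.span (Set.range z)) (z j₀)) (Localization.AtPrime ((𝔔₃.comap (AdjoinRoot.mk h')).comap Polynomial.C)))).comp (algebraMap R (blowupAlgebra (Ideal.span (Set.range z)) (z j₀))) := ⟨_, rfl⟩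
  obtain ⟨β, hβ⟩ : ∃ β : (R[X] ⧸ Ideal.span {h}) →+* R'[X] ⧸ Ideal.span {h₂}, β =
    (β₄.comp (β₃.comp β₂)).comp ((algebraMap (blowupAlgebra ((stalkIdeal C s.pt).map φ) (φ (c j))) (Localization.AtPrime 𝔔')).comp
      (algebraMap (R[X] ⧸ Ideal.span {h}) (blowupAlgebra ((stalkIdeal C s.pt).map φ) (φ (c j))))) := ⟨_, rfl⟩
  have hβq : ∀ q : R[X], β (Ideal.Quotient.mk _ q) = β₄ (β₃ (algebraMap (AdjoinRoot h') (Localization.AtPrime 𝔔₃)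
      (AdjoinRoot.mk h' (eval₂ (Polynomial.C.comp (algebraMap R (blowupAlgebra (Ideal.span (Set.range z)) (z j₀)))) (Polynomial.C (algebraMap R (blowupAlgebra (Ideal.span (Set.range z)) (z j₀)) (z j₀)) * X) q)))) := by
    intro q
    rw [hβ]
    exact congrArg β₄ (congrArg β₃ (hβ₂ q))
  have hβC : ∀ r : R, β (Ideal.Quotient.mk _ (Polynomial.C r)) = Ideal.Quotient.mk _ (Polynomial.C (ιR r)) := by
    intro r
    have h1 : AdjoinRoot.mk h' (eval₂ (Polynomial.C.comp (algebraMap R (blowupAlgebra (Ideal.span (Set.range z)) (z j₀))))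
        (Polynomial.C (algebraMap R (blowupAlgebra (Ideal.span (Set.range z)) (z j₀)) (z j₀)) * X) (Polynomial.C r)) =
        AdjoinRoot.of h' (algebraMap R (blowupAlgebra (Ideal.span (Set.range z)) (z j₀)) r) := by
      rw [eval₂_C, RingHom.comp_apply, AdjoinRoot.mk_C]
    rw [hβq, h1, hβ₃c, hβ₄c, hιR]
    rfl
  have hβX : β (Ideal.Quotient.mk _ X) ∈ Ideal.span {Ideal.Quotient.mk _ (Polynomial.C (ιR (z j₀)))} := by
    have h1 : AdjoinRoot.mk h' (eval₂ (Polynomial.C.comp (algebraMap R (blowupAlgebra (Ideal.span (Set.range z)) (z j₀))))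
        (Polynomial.C (algebraMap R (blowupAlgebra (Ideal.span (Set.range z)) (z j₀)) (z j₀)) * X) X) =
        AdjoinRoot.of h' (algebraMap R (blowupAlgebra (Ideal.span (Set.range z)) (z j₀)) (z j₀)) * AdjoinRoot.root h' := by
      rw [eval₂_X, map_mul, AdjoinRoot.mk_C, AdjoinRoot.mk_X]
    -- the composite `AdjoinRoot h' → R'[X]/(h₂)` through `β₃`, `β₄`
    obtain ⟨γ, hγ⟩ : ∃ γ : AdjoinRoot h' →+* R'[X] ⧸ Ideal.span {h₂},
        γ = β₄.comp (β₃.comp (algebraMap (AdjoinRoot h') (Localization.AtPrime 𝔔₃))) := ⟨_, rfl⟩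
    have hγof : γ (AdjoinRoot.of h' (algebraMap R (blowupAlgebra (Ideal.span (Set.range z)) (z j₀)) (z j₀))) =
        Ideal.Quotient.mk _ (Polynomial.C (ιR (z j₀))) := by
      rw [hγ, RingHom.comp_apply, RingHom.comp_apply, hβ₃c, hβ₄c, hιR]
      rfl
    have h3 : β (Ideal.Quotient.mk _ X) = γ (AdjoinRoot.mk h' (eval₂ (Polynomial.C.comp (algebraMap R (blowupAlgebra (Ideal.span (Set.range z)) (z j₀))))
        (Polynomial.C (algebraMap R (blowupAlgebra (Ideal.span (Set.range z)) (z j₀)) (z j₀)) * X) X)) := by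
      rw [hβq, hγ]
      rfl
    have h2 : β (Ideal.Quotient.mk _ X) = Ideal.Quotient.mk _ (Polynomial.C (ιR (z j₀))) * γ (AdjoinRoot.root h') := by
      rw [h3, h1, map_mul, hγof]
    rw [h2]
    exact Ideal.mul_mem_right _ _ (Ideal.mem_span_singleton_self _)
  refine ⟨R', inferInstance, inferInstance, ι ∘ u₁, h₂, φ₂, β, ιR, eT j₀,
    ⟨hreg', hloc₂, hdim', hu', hmon₂, hl₂, hf₂, hm₂, hr₂, hmin₂⟩, hcpl, hdeg₂.trans hdeg₁, hco₂, fun a => ?_, hβC, hβX,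
    heTmem j₀, ?_, fun jj hjj hne => ?_, fun jj hjj => ?_⟩
  · -- compatibility with `π♯` and `φ`
    have e1 := hφ₂ (((blowup.π C).stalkMap x').hom a)
    have e2 := hφ₁ (((blowup.π C).stalkMap x').hom a)
    have e3 := hψ₃ (((blowup.π C).stalkMap x').hom a)
    have e4 := h6 a
    refine (e1.trans (congrArg β₄ (e2.trans (congrArg β₃ (e3.trans (congrArg β₂ e4)))))).trans ?_
    rw [hβ]
    rfl
  · -- the exceptional parameter
    show ι (u₁ (eT j₀)) = ιR (u (eT j₀))
    rw [hu₁T, hzL0, ← hzj j₀, hιR]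
    rfl
  · -- an index of the centre other than `j₀`: `ι u_j = ι u_{j₀} · t`
    obtain ⟨kk, hkk⟩ : ∃ kk : Fin T.card, (eT kk : Fin 3) = jj := ⟨eT.symm ⟨jj, hjj⟩, by rw [eT.apply_symm_apply]⟩
    subst hkk
    have hkne : kk ≠ j₀ := fun h0 => hne (by rw [h0])
    refine ⟨ι (algebraMap (blowupAlgebra (Ideal.span (Set.range z)) (z j₀))
      (Localization.AtPrime ((𝔔₃.comap (AdjoinRoot.mk h')).comap Polynomial.C))
      (blowupAlgebra.gen (Ideal.span (Set.range z)) (z j₀) (z kk) (Ideal.mem_span_range_self (f := z) (x := kk)))), ?_, ?_⟩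
    · rw [← hzj kk, ← hzj j₀, hιR]
      simp only [RingHom.comp_apply]
      rw [← map_mul, ← map_mul, blowupAlgebra.algebraMap_mul_gen]
    · by_cases hmem : blowupAlgebra.gen (Ideal.span (Set.range z)) (z j₀) (z kk) (Ideal.mem_span_range_self (f := z) (x := kk)) ∈
          (𝔔₃.comap (AdjoinRoot.mk h')).comap Polynomial.C
      · left
        show _ = ι (u₁ (eT kk))
        rw [hu₁T, hzLA kk hkne hmem]
      · right
        exact ((IsLocalization.AtPrime.isUnit_to_map_iff (Localization.AtPrime ((𝔔₃.comap (AdjoinRoot.mk h')).comap Polynomial.C))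
          ((𝔔₃.comap (AdjoinRoot.mk h')).comap Polynomial.C) _).mpr hmem).map ι
  · -- an index off the centre
    obtain ⟨kk, hkk⟩ : ∃ kk : Fin Tᶜ.card, (eTc kk : Fin 3) = jj :=
      ⟨eTc.symm ⟨jj, Finset.mem_compl.mpr hjj⟩, by rw [eTc.apply_symm_apply]⟩
    subst hkk
    show ι (u₁ (eTc kk)) = ιR (u (eTc kk))
    rw [hu₁Tc, hyL, hιR]
    rfl

end Summit.ResolutionOfSingularities.ResolutionOfSingularities.Theorems.SigmaMaxModificationsCorridor3.Moving

end
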